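import Summits.SmoothPoincare4.SmoothPoincare4.Theses.TwistorRealLines

/-!
# Birth skeleton (BC3) — crux `TwistorRealLines.TwistorSymplecticRigidity` (stmt-SmoothPoincare4-5327)

Route `route-SmoothPoincare4-TwistorRealLines`, crux rank 4, `TwistorSymplecticRigidity` (= R, Fine–Krasnov–Panov
arXiv:1312.2831 Conjecture 21 restricted to homotopy 4-spheres): every smooth homotopy 4-sphere `M` (bare carrier
exactly as in `SmoothPoincare4`) carrying a smooth orientation `o` and a Riemannian metric `g` of POSITIVE
TWISTOR-SYMPLECTIC TYPE (framewise FKP inequality `|Bᵀu|² < |Au|²`, `uᵀAu > 0` on `o`-positive `g`-orthonormal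
frames) is diffeomorphic to `S⁴`. The crux is FIXED (decl and signature are the route's; never restated here).

## The line = the route's own ENGINE (route file, TWO-LAYER PLAN: "TwistorSymplecticRigidity ⇐ TwistorToStandard →
RealCongruenceRigidity → TwistorSymplecticRigidity, glue = the dictionary (FKP Thm 20 / FinePanov2009 Lemma)")

Three registered stubs, all stated over declarations the route file already uses (no new vocabulary):

* `stub_realCongruenceOfPositiveType` (OPEN; = the route's rank-5 crux `TwistorToStandard`, stmt-SmoothPoincare4-6761,
  in the FIBRED form the engine consumes, composed with the FKP dictionary): for a homotopy 4-sphere `M` with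
  `(o, g)` of positive type there are an `ω_FS`-tame, `τ₀`-real smooth almost complex structure `J` on
  `ℂP³ = ComplexProjectiveSpace 3` and a `τ₀`-real `J`-line congruence `p : ℂP³ → M` (smooth surjective submersion,
  `p ∘ τ₀ = p`, `J`-invariant vertical bundle, fibres `≃ₜ S²`). Why plausibly true: (i) FKP Thm 20 + Fine–Panov
  Lemma: positive type ⇔ the Levi-Civita connection on `Λ⁺` is positive definite ⇔ Reznikov's closed coupling form
  `ω_g` on the twistor space `Z = S(Λ⁺M)` is symplectic and tames the Atiyah–Hitchin–Singer structure `J₊`, whose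
  twistor fibres are `J₊`-holomorphic spheres and whose antipodal map `τ_g` is free and `J₊`-antiholomorphic
  (theorems in print); (ii) the smooth identification `(Z(M), τ_g) ≅ (ℂP³, τ₀)` (Wall 1966 / the `S²`-bundle over the
  h-cobordism `M ∼ S⁴`, route review Note-TwistorToStandard.md); (iii) the SYMPLECTIC identification
  `(Z, ω_g, τ_g) ≅ (ℂP³, c·ω_FS, τ₀)` equivariantly (FKP Conj 19 ∘ `τ`-equivariance — the open content of the
  intended proof); push `(J₊, π)` forward. Implied outright by `SmoothPoincare4` (take `J = J₀`, `p` = the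
  quaternionic Hopf fibration `ℂP³ → ℍP¹ = S⁴ ≅ M`), so it adds no falsity risk beyond the summit. Its typed layer-2 split
  (package existence = FKP Thm 20 + AHS · equivariant symplectic standardness · push-forward API) waits for the
  hypothesis package `defn-TwistorPackage` (route file, DEFINITION REQUESTS): positing the twistor package
  abstractly here would make piece (iii) strictly stronger than the route's crux. [FineKrasnovPanov2014, Thm 20,
  Conj 19] [FinePanov2009] [Reznikov1993] [AtiyahHitchinSinger1978] [Wall1966]
* `stub_realCongruenceRigidity` (OPEN; literally the route's rank-2 crux `RealCongruenceRigidity`,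
  stmt-SmoothPoincare4-6745, BY NAME — the ENGINE): a `τ₀`-real `J`-line congruence of `(ℂP³, ω_FS, τ₀)` with `J`
  tame and `τ₀`-real has leaf space diffeomorphic to `S⁴`. [Gromov1985] [HoferLizanSikorav1997] [Welschinger2005]
  [GeorgievaZinger2018] [Hitchin1981]
* `stub_quaternionicRealStructure_contMDiff` (KNOWN, wished Literature API, size M in Lean): the quaternionic real
  structure `τ₀ = QuaternionicRealStructure 1` of `ℂP³` is `C^∞` for the tree's affine charts (in the charts
  `U_i → U_{π(i)}` it is a signed coordinate permutation composed with complex conjugation, i.e. real-linear).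
  It is an explicit hypothesis of `RealCongruenceRigidity` (the API lemma is not in the tree:
  `Literature/Topology/FourManifolds/QuaternionicRealStructure.lean`, "Not here (wished API)"), so the assembly must
  discharge it. [Besse1987, 13.64–13.66] [AtiyahHitchinSinger1978, §4]

`TwistorSymplecticRigidity_of : TwistorSymplecticRigidity` — THE SKELETON THEOREM, concluding the crux BY NAME from the
three stubs: given `M`, `he : M ≃ₕ S⁴` and the positive-type witness, stub 1 produces `(J, p)`, and stub 2 (fed
stub 3 for the smoothness of `τ₀`) applied with `B := M` returns `Nonempty (M ≃ₘ S⁴)`. Its proof term is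
`sorry`-free; the file's only `sorry`s are the three stub bodies.

## Disproof used / negatives

`ledger crux ls stmt-SmoothPoincare4-5327`: no workfiles (no `Disproof.lean`, no dead lines, no landed `Negative/`
lemma) as of 2026-08-17; `ledger negatives --problem SmoothPoincare4`: 0 refuted statements. So no
`_false_without_` obstruction exists to honour and no stub is an instance of a landed Negative lemma. The refuter /
grounder record on the item (notes 2026-08-15): hypothesis satisfiable (round `S⁴`: `B = 0`, `A = 2·Id`), conclusion
is SPC4 for such `M`, open in print (FKP Conj 21); intended engine = 6761 → 6745 — exactly this skeleton.

## BC3 probes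

For each stub `X`: `X → TwistorSymplecticRigidity` and `X → SmoothPoincare4` by `first | exact? | simpa | aesop`
(files `bc/probe_*.lean` in the registrar's folder) — all must FAIL; results in the registrar's NOTES.md and in the
evidence note on the item.
-/

-- `Summit.<Summit>.<Problem>`: single-conjunct summit, the duplicate component is mandated (CONVENTIONS §2).
set_option linter.dupNamespace false
set_option linter.unusedVariables false

noncomputable section

namespace Summit.SmoothPoincare4.SmoothPoincare4.Cruxes.TwistorSymplecticRigidity.Birth

open scoped Manifold ContDiff Topology Matrix ContinuousMap
open Set Function
open Literature.Topology.FourManifolds Literature.Geometry.Symplectic Literature.Geometry.Kaehler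
open Literature.Geometry.Lorentzian (PseudoRiemannianMetric)
open Summit.SmoothPoincare4.SmoothPoincare4.Theses.TwistorRealLines

/-! ## The three registered stubs -/

/-- **Stub 1 `stub_realCongruenceOfPositiveType` — a positive-type homotopy 4-sphere is the leaf space of a
`τ₀`-real `J`-line congruence of `(ℂP³, ω_FS, τ₀)`** (the route's rank-5 crux `TwistorToStandard`,
stmt-SmoothPoincare4-6761, in fibred form, composed with the FKP Thm 20 / Fine–Panov dictionary). For every smooth
4-manifold `M` (Hausdorff, second countable, `C^∞` on `ℝ⁴`) with `M ≃ₕ S⁴` carrying a smooth orientation `o` and a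
Riemannian metric `g` with Levi-Civita connection satisfying the framewise positive-type inequality (verbatim the
hypothesis of the crux), there exist a `C^∞` almost complex structure `J` on `ComplexProjectiveSpace 3` tamed by the
Fubini–Study form `fubiniStudyMFormCP 3` and anti-commuting with the differential of
`τ₀ = QuaternionicRealStructure 1` (`dτ₀ ∘ J = -J ∘ dτ₀`), and a map `p : ℂP³ → M` that is `C^∞`, surjective,
submersive, `τ₀`-invariant (`p ∘ τ₀ = p`), with `J`-invariant vertical bundle (`dp v = 0 → dp (Jv) = 0`) and fibres
homeomorphic to `S²`. Open — the intended proof is the twistor congruence of `(M, o, g)` pushed forward along an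
equivariant symplectomorphism `(Z(M), ω_g, τ_g) ≅ (ℂP³, c·ω_FS, τ₀)` (FKP Thm 20 dictionary + FKP Conj 19 ∘
`τ`-equivariance = the route's `TwistorToStandard`); implied by `SmoothPoincare4` (`J = J₀`, `p` = the quaternionic
Hopf fibration composed with `S⁴ ≅ M`), so no falsity risk beyond the summit.
[FineKrasnovPanov2014, Thm 20, Conj 19] [FinePanov2009] [Reznikov1993] [AtiyahHitchinSinger1978] [Wall1966] -/
theorem stub_realCongruenceOfPositiveType :
    ∀ (M : Type) [TopologicalSpace M] [T2Space M] [SecondCountableTopology M]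
      [ChartedSpace (EuclideanSpace ℝ (Fin 4)) M] [IsManifold (𝓡 4) ∞ M],
      M ≃ₕ (Metric.sphere (0 : EuclideanSpace ℝ (Fin 5)) 1) →
      (∃ (o : Literature.Topology.FourManifolds.SmoothOrientation (𝓡 4) M)
          (g : Literature.Geometry.Lorentzian.PseudoRiemannianMetric (𝓡 4) ∞ (EuclideanSpace ℝ (Fin 4))
            (TangentSpace (𝓡 4) : M → Type _)),
          ∃ _ : g.HasLeviCivita, g.IsRiemannian ∧
            ∀ (x : M) (e : Fin 4 → TangentSpace (𝓡 4) x), g.IsOrthonormalFrame x e →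
              0 < Module.Ray.someVector (o x) (fun i => e (Fin.cast finrank_euclideanSpace_fin i)) →
              ∀ u : Fin 3 → ℝ, u ≠ 0 →
                dotProduct (Matrix.vecMul u (g.blockB g.leviCivita x e)) (Matrix.vecMul u (g.blockB g.leviCivita x e)) <
                    dotProduct (Matrix.mulVec (g.blockA g.leviCivita x e) u)
                      (Matrix.mulVec (g.blockA g.leviCivita x e) u) ∧
                  0 < dotProduct u (Matrix.mulVec (g.blockA g.leviCivita x e) u)) →
      ∃ (J : AlmostComplexStructure (𝓡 (2 * 3)) ∞ (ComplexProjectiveSpace 3))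
        (p : ComplexProjectiveSpace 3 → M),
        J.IsTamedBy (fubiniStudyMFormCP 3) ∧
        (∀ (z : ComplexProjectiveSpace 3) (v : TangentSpace (𝓡 (2 * 3)) z),
            mfderiv (𝓡 (2 * 3)) (𝓡 (2 * 3))
                (⇑(QuaternionicRealStructure 1) : ComplexProjectiveSpace 3 → ComplexProjectiveSpace 3) z (J z v) =
              -(J (QuaternionicRealStructure 1 z)
                  (mfderiv (𝓡 (2 * 3)) (𝓡 (2 * 3))
                    (⇑(QuaternionicRealStructure 1) : ComplexProjectiveSpace 3 → ComplexProjectiveSpace 3) z v))) ∧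
        ContMDiff (𝓡 (2 * 3)) (𝓡 4) ∞ p ∧
        Function.Surjective p ∧
        (∀ z, Function.Surjective (mfderiv (𝓡 (2 * 3)) (𝓡 4) p z)) ∧
        (∀ z, p (QuaternionicRealStructure 1 z) = p z) ∧
        (∀ (z : ComplexProjectiveSpace 3) (v : TangentSpace (𝓡 (2 * 3)) z),
            mfderiv (𝓡 (2 * 3)) (𝓡 4) p z v = 0 → mfderiv (𝓡 (2 * 3)) (𝓡 4) p z (J z v) = 0) ∧
        (∀ x : M, Nonempty (↥(p ⁻¹' {x}) ≃ₜ (Metric.sphere (0 : EuclideanSpace ℝ (Fin 3)) 1))) := by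
  sorry

/-- **Stub 2 `stub_realCongruenceRigidity` — the ENGINE, literally the route's rank-2 crux `RealCongruenceRigidity`
(stmt-SmoothPoincare4-6745) BY NAME:** for `J` a smooth `ω_FS`-tame almost complex structure on `ℂP³` with
`dτ₀ ∘ J = -J ∘ dτ₀` (`τ₀` smooth), every smooth surjective submersion `p : ℂP³ → B` onto a smooth 4-manifold with
`p ∘ τ₀ = p`, `J`-invariant vertical bundle and fibres `≃ₜ S²` has `B` diffeomorphic to `S⁴` (push the congruence
along a wall-free path of real tame `J` to the quaternionic congruence `ℂP³ → ℍP¹`; a parametrised real-line moduli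
space without critical points is a proper submersion over `[0,1]`). Open.
[Gromov1985] [HoferLizanSikorav1997] [Welschinger2005] [GeorgievaZinger2018] [Hitchin1981] -/
theorem stub_realCongruenceRigidity : RealCongruenceRigidity := by
  sorry

/-- **Stub 3 `stub_quaternionicRealStructure_contMDiff` — smoothness of the quaternionic real structure `τ₀` on
`ℂP³`** (`[z₀:z₁:z₂:z₃] ↦ [-z̄₁:z̄₀:-z̄₃:z̄₂]`, `QuaternionicRealStructure 1`) for the tree's affine charts of
`ComplexProjectiveSpace 3` (model `𝓡 (2·3)`): in the charts `U_i → U_{π(i)}` it is a signed permutation of the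
affine coordinates composed with complex conjugation, hence real-linear and `C^∞` (indeed real-analytic,
anti-holomorphic). Known; wished API of `Literature/Topology/FourManifolds/QuaternionicRealStructure.lean`, and an
explicit hypothesis of `RealCongruenceRigidity` that the assembly must discharge. [Besse1987, 13.64–13.66]
[AtiyahHitchinSinger1978, §4] -/
theorem stub_quaternionicRealStructure_contMDiff :
    ContMDiff (𝓡 (2 * 3)) (𝓡 (2 * 3)) ∞
      (⇑(QuaternionicRealStructure 1) : ComplexProjectiveSpace 3 → ComplexProjectiveSpace 3) := by
  sorry

/-! ## The composition (kernel-checked; no `sorry` of its own) -/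

/-- **THE SKELETON THEOREM: the crux `TwistorRealLines.TwistorSymplecticRigidity` BY NAME from the three declared
stubs.** Given a homotopy 4-sphere `M` (`he : M ≃ₕ S⁴`) with a positive-type witness `(o, g)`: stub 1 yields an
`ω_FS`-tame `τ₀`-real `J` on `ℂP³` and a `τ₀`-real `J`-line congruence `p : ℂP³ → M`; stub 2 (the route's crux
`RealCongruenceRigidity`), fed the smoothness of `τ₀` (stub 3) and applied with `B := M`, returns
`Nonempty (M ≃ₘ⟮𝓡 4, 𝓡 4⟯ S⁴)`. Pure logic; the only `sorry`s of the file are the stub bodies. [folklore] -/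
theorem TwistorSymplecticRigidity_of :
    Summit.SmoothPoincare4.SmoothPoincare4.Theses.TwistorRealLines.TwistorSymplecticRigidity := by
  intro M _ _ _ _ _ he hpos
  obtain ⟨J, p, hJtame, hJreal, hp, hpsurj, hpsub, hpτ, hpJ, hfib⟩ :=
    stub_realCongruenceOfPositiveType M he hpos
  exact stub_realCongruenceRigidity J hJtame stub_quaternionicRealStructure_contMDiff hJreal M p hp hpsurj
    hpsub hpτ hpJ hfib

end Summit.SmoothPoincare4.SmoothPoincare4.Cruxes.TwistorSymplecticRigidity.Birth

end
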